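import Summits.BirchSwinnertonDyer.Rank1Residual.Additive.MazurTateGrowthDichotomyThree
import Summits.BirchSwinnertonDyer.Rank1Residual.Additive.SelectorIdentityTameThreeProofs
import Summits.BirchSwinnertonDyer.Rank1Residual.Additive.SelectorIdentityTameThreeHolds
import HarnessLib

/-!
# The growth-dichotomy BRIDGES of `Additive/MazurTateGrowthDichotomyThree.lean` with their `hsel` binder FED:
# T9 ⟺ the `LocIrr` form on `j ≠ 1728` — §1 per curve modulo the cited Table II conductor column,
# §2 (appended the same day) UNCONDITIONALLY via `Additive.selectorIdentityTameThree_holds`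
# (cell `b2b-bsdres`, lane CLASS-CLOSURE, seat cc-typer-5 GEN 9 = O5/O6 typer of record; KERNEL BOOKKEEPING —
#  theorems only, 0 definitions, 0 `@[conjecture]` nodes, 0 named Literature facts; nothing asserted about any curve)

HONEST FRAMING (cell `b2b-bsdres`, run/shared/lean/b2b/bsd-rank1-residual/, verbatim in every file):
the goal of the cell is to DELETE the COMBINATION-SHAPED residual classes of the Birch–Swinnerton-Dyer
formula for ALL analytic-rank `≤ 1` elliptic curves over `ℚ` — "full BSD formula for every rank `≤ 1`
curve in class `C`" assembled STRICTLY from published theorems — so that the rank-`≤ 1` remainder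
becomes exactly the CONSTRUCTION-SHAPED classes, which are TYPED (missing-input `Prop`s), NOT
attempted. This is not "finishing BSD". Lane CLASS-CLOSURE (`CLASS-CLOSURE-PLAN.md` §3.4 O6 / §3.5 O5):
research routes; no claim beyond the stated classes; census output is EVIDENCE, never a Literature
fact; nothing is booked; no mark of `RESIDUAL-MAP.md` moves. This file: THEOREMS ONLY — the three PROVED
bridges of `Additive/MazurTateGrowthDichotomyThree.lean` (cc-typer-5 GEN 3, p256309) composed with the
cross-cell derivation `Additive.selectorIdentityTameThree_of_tableII` /
`Additive.locIrr_three_iff_seven_le_of_subTprime_of_tableII` (x11b3-p7 GEN 7, p297328,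
`Additive/SelectorIdentityTameThreeProofs.lean`). The `@[conjecture]` nodes `O5.GrowthDichotomyLawThree` (T9,
`O5/O5GrowthLaws.lean`) and `O5.GrowthDichotomyLawLocIrrThree` (node of record) are UNTOUCHED and enter only
as explicit hypotheses `h9` / `hL`.

## What (GEN 8 handoff item (1), unlocked by p297328 at 2026-08-21T18:15Z)

The bridges `growthDichotomy_locIrr_of_growthDichotomyLaw`, `growthDichotomyLaw_conclusion_of_locIrr` and
`growthDichotomyLawThree_of_ne_1728` take `hsel : SelectorIdentityTameThree` (cc-typer-5's TARGET: on the
tame potentially supersingular cell, `j ≠ 1728`, `LocIrr W 3 ↔ 7 ≤ v₃(j − 1728)`; EVIDENCE 36 323 / 0). That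
target is now DERIVED modulo ONE cited named fact — the `v(N)` column of Rizzo's Table II at `3`,
`WeierstrassCurve.conductorExponent_eq_tableConductorExponentThree` (`Literature/…/RootNumberTableThree.lean`;
Tate's algorithm at `3` versus the printed table; NOT discharged, NOT restated here) — so the bridges hold
with `hsel` replaced by that fact:

* `growthDichotomy_locIrr_of_growthDichotomyLaw_of_tableII` — T9 (`h9`) + Table II FOR THIS `W` (`h3`)
  ⟹ the `LocIrr` form's conclusion at `W` (`j ≠ 0, 1728`); PER-CURVE: only `h3 : W.conductorExponent_eq_…`
  for the curve at hand is used (via the per-curve `locIrr_three_iff_seven_le_of_subTprime_of_tableII`,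
  which needs `SubTprime W 3` and `j ≠ 1728` — `ClassO5` is carried only because the laws quantify over it);
* `growthDichotomyLaw_conclusion_of_locIrr_of_tableII` — the node of record (`hL`) + Table II for this `W`
  ⟹ T9's conclusion at `W` (`j ≠ 0, 1728`);
* `growthDichotomyLawThree_of_ne_1728_of_tableII` — the node of record + Table II for EVERY `W`
  ⟹ T9's full statement on `j ≠ 1728` (= `growthDichotomyLawThree_of_ne_1728 hL
  (selectorIdentityTameThree_of_tableII h3)`, x11b3-p7's "Effect for consumers" sentence as a term).

Reading (EVIDENCE wording, unchanged): "T9 and the `LocIrr` form of the O5b growth dichotomy are EQUIVALENT on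
`j ≠ 1728` modulo the cited Table II conductor column alone; both laws remain `@[conjecture]` nodes; census
36 323 / 0 and 194 / 194 stay EVIDENCE; nothing booked; no mark."  Not here: any discharge of the Table II
fact; anything at `j = 1728` (there only the `LocIrr` form speaks, `locIrr_three_of_c₆_eq_zero'`); any census.

## §2 (appended 2026-08-21, same seat and generation): the bridges UNCONDITIONALLY

x11b3-p7 GEN 7 then PROVED the selector identity with NO Table II binder —
`Additive.selectorIdentityTameThree_holds : SelectorIdentityTameThree` (`Additive/SelectorIdentityTameThreeHolds.lean`
p298753: Tate's algorithm Steps 4 / 9 bracket lemma + (t′) ⟺ III/III* + L-O56-sel). §2 records the three bridges with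
`hsel := selectorIdentityTameThree_holds`: `growthDichotomy_locIrr_of_growthDichotomyLaw'` (T9 ⟹ the `LocIrr` form's
conclusion, `j ≠ 0, 1728`), `growthDichotomyLaw_conclusion_of_locIrr'` (node of record ⟹ T9's conclusion) and
`growthDichotomyLawThree_of_ne_1728'` (node of record ⟹ T9's full statement on `j ≠ 1728`) — i.e. **T9
(`O5.GrowthDichotomyLawThree`) and the node of record (`O5.GrowthDichotomyLawLocIrrThree`) are EQUIVALENT on
`j ≠ 0, 1728` with NO residual hypothesis**; §1 stays as landed (superseded for consumers, still the per-curve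
bookkeeping modulo one table row). Reading unchanged otherwise: both laws remain `@[conjecture]` nodes; census stays
EVIDENCE; nothing booked; no mark.

References: O. Rizzo, Compositio Math. 136 (2003) 1–23, Table II (p. 4), column `v(N)` [Rizzo2003];
L. Doyon, A. Lei, arXiv:2103.06154 §6 [DoyonLei2021]; A. Lei, R. Pollack, N. Pratap, arXiv:2412.16629 Thm 4.5,
§4.3, Conj. 4.11 [LeiPollackPratap2024]; O. Fouquet, X. Wan, arXiv:2107.13726 Thm 5.1 (the (Lgl) bit)
[FouquetWan2021]; records `class-closure/O6/TYPED.md` §7 / §12 / §13, `HOME/b2b-bsdres-harvest-2/gen42/E89-LocIrr3-kernel.md` §4.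
-/

set_option autoImplicit false

noncomputable section

open scoped Classical MatrixGroups ModularForm NumberField

open CongruenceSubgroup Polynomial WeierstrassCurve NumberField Literature.NumberTheory.EllipticCurves
  Literature.NumberTheory.EllipticCurves.ModularForms
  Literature.NumberTheory.EllipticCurves.Rank1Residual
  Literature.NumberTheory.EllipticCurves.Rank1Residual.Typed
  Summit.BirchSwinnertonDyer.Rank1Residual.X1.MuLambda

namespace Summit.BirchSwinnertonDyer.Rank1Residual.O5

open Summit.BirchSwinnertonDyer.Rank1Residual.Additive

/-- **BRIDGE, `hsel` fed per curve: T9 + Table II's `v(N)` at `3` for THIS `W` ⇒ the `LocIrr` form's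
conclusion at `W` (`j ≠ 0, 1728`).** The selector `7 ≤ v₃(j − 1728)` of T9 is exchanged for `LocIrr W 3` by
`locIrr_three_iff_seven_le_of_subTprime_of_tableII W h3 hT hj` (L-O56-sel, a theorem, + the cited table
row); nothing else is used. [cite: Rizzo2003, Table II (p. 4), column v(N)] -/
theorem growthDichotomy_locIrr_of_growthDichotomyLaw_of_tableII (h9 : GrowthDichotomyLawThree)
    (W : WeierstrassCurve ℚ) [W.IsElliptic] [W.IsGloballyMinimal] [NeZero (W.conductorNorm ℤ)]
    (h3 : W.conductorExponent_eq_tableConductorExponentThree)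
    (f : CuspForm (Gamma0 (W.conductorNorm ℤ)) 2) (hf : IsNewformOf W f) (hO : ClassO5 W 3)
    (hT : SubTprime W 3) (hρ : W.HasIrreducibleModPGaloisRep 3) (hj0 : W.j ≠ 0) (hj : W.j ≠ 1728) :
    ∃ n₀ c₀ c₁ : ℕ, (¬ LocIrr W 3 → c₀ = c₁) ∧
      ∀ (n k : ℕ) (Θ : IwasawaAlgebra 3), n₀ ≤ n → IsScaledMazurTateLift f n k Θ → Θ ≠ 0 →
        lam Θ = (if padicValRat 3 W.Δ = 9 then 2 else 1) * 3 ^ (n - 1) +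
          (if LocIrr W 3 then kuriharaQ (n - 1) else 0) +
          (if n % 2 = 0 then c₀ else c₁) := by
  obtain ⟨n₀, c₀, c₁, hc, hlaw⟩ := h9 W f hf hO hT hρ hj0
  have key : LocIrr W 3 ↔ 7 ≤ padicValRat 3 (W.j - 1728) :=
    locIrr_three_iff_seven_le_of_subTprime_of_tableII W h3 hT hj
  refine ⟨n₀, c₀, c₁, fun hnL ↦ hc (not_le.mp fun h7 ↦ hnL (key.mpr h7)), ?_⟩
  intro n k Θ hn hΘ hΘ0
  have hl := hlaw n k Θ hn hΘ hΘ0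
  by_cases hL : LocIrr W 3
  · rw [if_pos hL]; rwa [if_pos (key.mp hL)] at hl
  · rw [if_neg hL]; rwa [if_neg (fun h7 ↦ hL (key.mpr h7))] at hl

/-- **CONVERSE BRIDGE, `hsel` fed per curve: the node of record `GrowthDichotomyLawLocIrrThree` + Table II's
`v(N)` at `3` for THIS `W` ⇒ T9's conclusion at `W` (`j ≠ 0, 1728`).** With the previous theorem: the two
formulations are EQUIVALENT at every tame potentially supersingular `W` with `j ≠ 0, 1728`, modulo the
cited table row for `W` alone. [cite: Rizzo2003, Table II (p. 4), column v(N)] -/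
theorem growthDichotomyLaw_conclusion_of_locIrr_of_tableII (hL : GrowthDichotomyLawLocIrrThree)
    (W : WeierstrassCurve ℚ) [W.IsElliptic] [W.IsGloballyMinimal] [NeZero (W.conductorNorm ℤ)]
    (h3 : W.conductorExponent_eq_tableConductorExponentThree)
    (f : CuspForm (Gamma0 (W.conductorNorm ℤ)) 2) (hf : IsNewformOf W f) (hO : ClassO5 W 3)
    (hT : SubTprime W 3) (hρ : W.HasIrreducibleModPGaloisRep 3) (hj0 : W.j ≠ 0) (hj : W.j ≠ 1728) :
    ∃ n₀ c₀ c₁ : ℕ, (padicValRat 3 (W.j - 1728) < 7 → c₀ = c₁) ∧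
      ∀ (n k : ℕ) (Θ : IwasawaAlgebra 3), n₀ ≤ n → IsScaledMazurTateLift f n k Θ → Θ ≠ 0 →
        lam Θ = (if padicValRat 3 W.Δ = 9 then 2 else 1) * 3 ^ (n - 1) +
          (if 7 ≤ padicValRat 3 (W.j - 1728) then kuriharaQ (n - 1) else 0) +
          (if n % 2 = 0 then c₀ else c₁) := by
  obtain ⟨n₀, c₀, c₁, hc, hlaw⟩ := hL W f hf hO hT hρ hj0
  have key : LocIrr W 3 ↔ 7 ≤ padicValRat 3 (W.j - 1728) :=
    locIrr_three_iff_seven_le_of_subTprime_of_tableII W h3 hT hj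
  refine ⟨n₀, c₀, c₁, fun hlt ↦ hc (fun hLi ↦ absurd (key.mp hLi) (not_le.mpr hlt)), ?_⟩
  intro n k Θ hn hΘ hΘ0
  have hl := hlaw n k Θ hn hΘ hΘ0
  by_cases h7 : 7 ≤ padicValRat 3 (W.j - 1728)
  · rw [if_pos h7]; rwa [if_pos (key.mpr h7)] at hl
  · rw [if_neg h7]; rwa [if_neg (fun hLi ↦ h7 (key.mp hLi))] at hl

/-- **T9's statement on `j ≠ 1728` from the node of record, modulo Table II's `v(N)` column for every curve**
— `growthDichotomyLawThree_of_ne_1728` with `hsel := selectorIdentityTameThree_of_tableII h3` (x11b3-p7's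
"Effect for consumers" sentence, as a term). [cite: Rizzo2003, Table II (p. 4), column v(N)] -/
theorem growthDichotomyLawThree_of_ne_1728_of_tableII (hL : GrowthDichotomyLawLocIrrThree)
    (h3 : ∀ W : WeierstrassCurve ℚ, W.conductorExponent_eq_tableConductorExponentThree) :
    ∀ (W : WeierstrassCurve ℚ) [W.IsElliptic] [W.IsGloballyMinimal] [NeZero (W.conductorNorm ℤ)]
      (f : CuspForm (Gamma0 (W.conductorNorm ℤ)) 2), IsNewformOf W f → ClassO5 W 3 → SubTprime W 3 →
      W.HasIrreducibleModPGaloisRep 3 → W.j ≠ 0 → W.j ≠ 1728 →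
      ∃ n₀ c₀ c₁ : ℕ, (padicValRat 3 (W.j - 1728) < 7 → c₀ = c₁) ∧
        ∀ (n k : ℕ) (Θ : IwasawaAlgebra 3), n₀ ≤ n → IsScaledMazurTateLift f n k Θ → Θ ≠ 0 →
          lam Θ = (if padicValRat 3 W.Δ = 9 then 2 else 1) * 3 ^ (n - 1) +
            (if 7 ≤ padicValRat 3 (W.j - 1728) then kuriharaQ (n - 1) else 0) +
            (if n % 2 = 0 then c₀ else c₁) :=
  growthDichotomyLawThree_of_ne_1728 hL (selectorIdentityTameThree_of_tableII h3)

/-- Sanity: the global Table II fact also feeds the ORIGINAL `SelectorIdentityTameThree`-shaped bridge, and the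
per-curve bridge is its specialisation (the two routes agree definitionally up to the proof of `key`).
[folklore] -/
example (h9 : GrowthDichotomyLawThree)
    (h3 : ∀ W : WeierstrassCurve ℚ, W.conductorExponent_eq_tableConductorExponentThree)
    (W : WeierstrassCurve ℚ) [W.IsElliptic] [W.IsGloballyMinimal] [NeZero (W.conductorNorm ℤ)]
    (f : CuspForm (Gamma0 (W.conductorNorm ℤ)) 2) (hf : IsNewformOf W f) (hO : ClassO5 W 3)
    (hT : SubTprime W 3) (hρ : W.HasIrreducibleModPGaloisRep 3) (hj0 : W.j ≠ 0) (hj : W.j ≠ 1728) :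
    ∃ n₀ c₀ c₁ : ℕ, (¬ LocIrr W 3 → c₀ = c₁) ∧
      ∀ (n k : ℕ) (Θ : IwasawaAlgebra 3), n₀ ≤ n → IsScaledMazurTateLift f n k Θ → Θ ≠ 0 →
        lam Θ = (if padicValRat 3 W.Δ = 9 then 2 else 1) * 3 ^ (n - 1) +
          (if LocIrr W 3 then kuriharaQ (n - 1) else 0) +
          (if n % 2 = 0 then c₀ else c₁) :=
  growthDichotomy_locIrr_of_growthDichotomyLaw h9 (selectorIdentityTameThree_of_tableII h3)
    W f hf hO hT hρ hj0 hj

/-! ## §2 The bridges UNCONDITIONALLY (`hsel := selectorIdentityTameThree_holds`, x11b3-p7 p298753) -/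

/-- **BRIDGE, unconditional: T9 ⇒ the `LocIrr` form's conclusion at every (t′) curve with `j ≠ 0, 1728`.**
`growthDichotomy_locIrr_of_growthDichotomyLaw` with `hsel := selectorIdentityTameThree_holds`; the only remaining
hypothesis is the law `h9` itself. [folklore] -/
theorem growthDichotomy_locIrr_of_growthDichotomyLaw' (h9 : GrowthDichotomyLawThree)
    (W : WeierstrassCurve ℚ) [W.IsElliptic] [W.IsGloballyMinimal] [NeZero (W.conductorNorm ℤ)]
    (f : CuspForm (Gamma0 (W.conductorNorm ℤ)) 2) (hf : IsNewformOf W f) (hO : ClassO5 W 3)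
    (hT : SubTprime W 3) (hρ : W.HasIrreducibleModPGaloisRep 3) (hj0 : W.j ≠ 0) (hj : W.j ≠ 1728) :
    ∃ n₀ c₀ c₁ : ℕ, (¬ LocIrr W 3 → c₀ = c₁) ∧
      ∀ (n k : ℕ) (Θ : IwasawaAlgebra 3), n₀ ≤ n → IsScaledMazurTateLift f n k Θ → Θ ≠ 0 →
        lam Θ = (if padicValRat 3 W.Δ = 9 then 2 else 1) * 3 ^ (n - 1) +
          (if LocIrr W 3 then kuriharaQ (n - 1) else 0) +
          (if n % 2 = 0 then c₀ else c₁) :=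
  growthDichotomy_locIrr_of_growthDichotomyLaw h9 selectorIdentityTameThree_holds W f hf hO hT hρ hj0 hj

/-- **CONVERSE BRIDGE, unconditional: the node of record `GrowthDichotomyLawLocIrrThree` ⇒ T9's conclusion at every
(t′) curve with `j ≠ 0, 1728`.** `growthDichotomyLaw_conclusion_of_locIrr` with `hsel := selectorIdentityTameThree_holds`.
[folklore] -/
theorem growthDichotomyLaw_conclusion_of_locIrr' (hL : GrowthDichotomyLawLocIrrThree)
    (W : WeierstrassCurve ℚ) [W.IsElliptic] [W.IsGloballyMinimal] [NeZero (W.conductorNorm ℤ)]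
    (f : CuspForm (Gamma0 (W.conductorNorm ℤ)) 2) (hf : IsNewformOf W f) (hO : ClassO5 W 3)
    (hT : SubTprime W 3) (hρ : W.HasIrreducibleModPGaloisRep 3) (hj0 : W.j ≠ 0) (hj : W.j ≠ 1728) :
    ∃ n₀ c₀ c₁ : ℕ, (padicValRat 3 (W.j - 1728) < 7 → c₀ = c₁) ∧
      ∀ (n k : ℕ) (Θ : IwasawaAlgebra 3), n₀ ≤ n → IsScaledMazurTateLift f n k Θ → Θ ≠ 0 →
        lam Θ = (if padicValRat 3 W.Δ = 9 then 2 else 1) * 3 ^ (n - 1) +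
          (if 7 ≤ padicValRat 3 (W.j - 1728) then kuriharaQ (n - 1) else 0) +
          (if n % 2 = 0 then c₀ else c₁) :=
  growthDichotomyLaw_conclusion_of_locIrr hL selectorIdentityTameThree_holds W f hf hO hT hρ hj0 hj

/-- **T9's statement on `j ≠ 1728` FROM THE NODE OF RECORD ALONE** — `growthDichotomyLawThree_of_ne_1728` with
`hsel := selectorIdentityTameThree_holds`: with `growthDichotomy_locIrr_of_growthDichotomyLaw'` the two `@[conjecture]`
laws are EQUIVALENT on `j ≠ 0, 1728`, no residual hypothesis (both stay conjecture nodes; nothing asserted). [folklore] -/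
theorem growthDichotomyLawThree_of_ne_1728' (hL : GrowthDichotomyLawLocIrrThree) :
    ∀ (W : WeierstrassCurve ℚ) [W.IsElliptic] [W.IsGloballyMinimal] [NeZero (W.conductorNorm ℤ)]
      (f : CuspForm (Gamma0 (W.conductorNorm ℤ)) 2), IsNewformOf W f → ClassO5 W 3 → SubTprime W 3 →
      W.HasIrreducibleModPGaloisRep 3 → W.j ≠ 0 → W.j ≠ 1728 →
      ∃ n₀ c₀ c₁ : ℕ, (padicValRat 3 (W.j - 1728) < 7 → c₀ = c₁) ∧
        ∀ (n k : ℕ) (Θ : IwasawaAlgebra 3), n₀ ≤ n → IsScaledMazurTateLift f n k Θ → Θ ≠ 0 →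
          lam Θ = (if padicValRat 3 W.Δ = 9 then 2 else 1) * 3 ^ (n - 1) +
            (if 7 ≤ padicValRat 3 (W.j - 1728) then kuriharaQ (n - 1) else 0) +
            (if n % 2 = 0 then c₀ else c₁) :=
  growthDichotomyLawThree_of_ne_1728 hL selectorIdentityTameThree_holds

end Summit.BirchSwinnertonDyer.Rank1Residual.O5

end
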